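import Summits.BirchSwinnertonDyer.BirchSwinnertonDyer.Theses.PAdicOrderV2
import Summits.BirchSwinnertonDyer.BirchSwinnertonDyer.Theses.SelmerRank
import Summits.BirchSwinnertonDyer.BirchSwinnertonDyer.Theorems.PAdicOrderV2PAdicOrderComparisonR2StubConstantCoeff
import Summits.BirchSwinnertonDyer.BirchSwinnertonDyer.Theorems.PAdicOrderV2PAdicOrderComparisonR2StubTwoLeOrder
import Literature.NumberTheory.EllipticCurves.KatoRankBound
import Literature.NumberTheory.EllipticCurves.KatoRankBoundSelmerProofs
import HarnessLib

/-!
# BirchSwinnertonDyer / PAdicOrderV2 — crux `PAdicOrderComparisonR2`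
# (stmt-BirchSwinnertonDyer-0489), line `Sketch`: what the crux is, exactly, after the landed legs,
# and the lower-bound half at odd `p` as literature debt

Crux #2 (`Summit.BirchSwinnertonDyer.BirchSwinnertonDyer.Theses.PAdicOrderV2.PAdicOrderComparisonR2`):
for `E/ℚ` (globally minimal `W`), every good ordinary prime `p` and the newform `f` of `E`,
`ord_{T=0} L_p(E, T) = ord_{s=1} L(E, s)` in `ℕ∞` (`L_p = padicLFunction f (unitRoot W p)`).

Two glue theorems of line `Sketch` (skeleton v8, `Cruxes/PAdicOrderComparisonR2/Lines/Sketch.lean`),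
both sorry-free and using only LANDED legs of the line:

* `pAdicOrderComparisonR2_iff_open_inequalities` (registered sub-goal of the crux): the crux is
  EQUIVALENT to the conjunction of three inequalities, each open in print —
  (UB1) `r_an = 1 → ord_T L_p ≤ 1` (rank-one Schneider non-degeneracy through Perrin-Riou's `p`-adic
  Gross–Zagier formula; the hard half of the sibling crux `PAdicOrderRankOneR4`),
  (UB2) `2 ≤ r_an → ord_T L_p ≤ r_an` (main conjecture ∧ `T`-semisimplicity ∧ control ∧ Selmer
  corank `≤ r_an`), and
  (LB3) `3 ≤ r_an → r_an ≤ ord_T L_p` ("`p`-adic order dominates").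
  Everything else is a tree theorem: `r_an = 0 ↔ ord = 0` and `1 ≤ ord` when `r_an ≥ 1` from the
  interpolation leg S1 (`stub_constantCoeff_eq_zero_iff`, p97010: `L_p(E,0) = 0 ↔ 1 ≤ r_an`), and
  `2 ≤ ord` when `r_an = 2` from the parity leg L2 (`stub_two_le_order_of_analyticRank_eq_two`,
  p99469).
* `pAdicOrderComparisonR2_lb_odd_of_kato` / `…_of_kato_divisibility`: at ODD `p` the lower bound
  `r_an ≤ ord_T L_p` for `r_an ≥ 2` is LITERATURE DEBT modulo the Selmer side — it follows from the
  ∀-closure of Kato's corank bound (tree fact `kato_selmerCorank_le_order_padicLFunction`, Kato,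
  Astérisque 295 (2004), Thm. 18.4; itself a tree THEOREM from Kato's divisibility Thm. 17.4,
  `kato_selmerCorank_le_order_padicLFunction_of_kato_divisibility`) and the Selmer-side equality
  `corank_{ℤ_p} Sel_{p^∞}(E/ℚ) = r_an` (`2 ≤ r_an`, odd good ordinary `p`), which
  `pAdicOrderComparisonR2_selmerSide_of_items` derives at `p ≥ 5` from route SelmerRank's items
  `SelmerRankLB`/`SelmerRankUB`/`SelmerRankSmallImage` and at `p = 3` from the same statement at
  `p = 3` (the line's stub SEL3, taken here as a hypothesis). No main conjecture, no
  semisimplicity, no control theorem beyond its proved easy half enter the lower bound.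

References: Kato, Astérisque 295 (2004), Thm. 17.4 (p. 273), Thm. 18.4 (p. 281); Mazur–Tate–
Teitelbaum, Invent. Math. 84 (1986), §II.10; Greenberg, LNM 1716 (1999), §1 p. 65.
-/

-- single-conjunct summit: `Summit.BirchSwinnertonDyer.BirchSwinnertonDyer.…` repeats the name
-- by design
set_option linter.dupNamespace false

namespace Summit.BirchSwinnertonDyer.BirchSwinnertonDyer.Theorems

open Summit.BirchSwinnertonDyer.BirchSwinnertonDyer.Theses.PAdicOrderV2
open Summit.BirchSwinnertonDyer.BirchSwinnertonDyer.Theses.SelmerRank (SelmerRankLB SelmerRankUB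
  SelmerRankSmallImage)
open Literature.NumberTheory.EllipticCurves

/-- **What crux #2 is, exactly, after line `Sketch`'s landed legs.** `PAdicOrderComparisonR2` is
EQUIVALENT to the conjunction of three inequalities, each open in print: (UB1)
`r_an = 1 → ord_T L_p ≤ 1`, (UB2) `2 ≤ r_an → ord_T L_p ≤ r_an`, (LB3) `3 ≤ r_an → r_an ≤ ord_T L_p`.
The remaining content of the crux — `r_an = 0 ↔ ord = 0`, `1 ≤ ord` when `r_an ≥ 1` (interpolation
leg S1, `stub_constantCoeff_eq_zero_iff`) and `2 ≤ ord` when `r_an = 2` (parity leg L2,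
`stub_two_le_order_of_analyticRank_eq_two`) — is a tree theorem, so `→` is projection and `←` is
order arithmetic in `ℕ∞`. [cite: MazurTateTeitelbaum1986Invent, §II.10] -/
theorem pAdicOrderComparisonR2_iff_open_inequalities :
    Summit.BirchSwinnertonDyer.BirchSwinnertonDyer.Theses.PAdicOrderV2.PAdicOrderComparisonR2 ↔
      ((∀ (W : WeierstrassCurve ℚ) [W.IsElliptic] [W.IsGloballyMinimal] (p : ℕ) [Fact p.Prime],
          Literature.NumberTheory.EllipticCurves.IsOrdinaryAt W p →
          ∀ {N : ℕ} [NeZero N] (f : CuspForm (CongruenceSubgroup.Gamma0 N) 2),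
          Literature.NumberTheory.EllipticCurves.ModularForms.IsNewformOf W f →
            W.analyticRank = 1 →
              (Literature.NumberTheory.EllipticCurves.padicLFunction f
                (Literature.NumberTheory.EllipticCurves.unitRoot W p : ℚ_[p])).order ≤ 1) ∧
        (∀ (W : WeierstrassCurve ℚ) [W.IsElliptic] [W.IsGloballyMinimal] (p : ℕ) [Fact p.Prime],
          Literature.NumberTheory.EllipticCurves.IsOrdinaryAt W p →
          ∀ {N : ℕ} [NeZero N] (f : CuspForm (CongruenceSubgroup.Gamma0 N) 2),
          Literature.NumberTheory.EllipticCurves.ModularForms.IsNewformOf W f →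
            2 ≤ W.analyticRank →
              (Literature.NumberTheory.EllipticCurves.padicLFunction f
                (Literature.NumberTheory.EllipticCurves.unitRoot W p : ℚ_[p])).order ≤ W.analyticRank) ∧
        (∀ (W : WeierstrassCurve ℚ) [W.IsElliptic] [W.IsGloballyMinimal] (p : ℕ) [Fact p.Prime],
          Literature.NumberTheory.EllipticCurves.IsOrdinaryAt W p →
          ∀ {N : ℕ} [NeZero N] (f : CuspForm (CongruenceSubgroup.Gamma0 N) 2),
          Literature.NumberTheory.EllipticCurves.ModularForms.IsNewformOf W f →
            3 ≤ W.analyticRank →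
              (W.analyticRank : ℕ∞) ≤ (Literature.NumberTheory.EllipticCurves.padicLFunction f
                (Literature.NumberTheory.EllipticCurves.unitRoot W p : ℚ_[p])).order)) := by
  constructor
  · intro h
    refine ⟨fun W _ _ p _ hord N _ f hf h1 => ?_, fun W _ _ p _ hord N _ f hf _ => (h W p hord f hf).le,
      fun W _ _ p _ hord N _ f hf _ => (h W p hord f hf).ge⟩
    rw [h W p hord f hf, h1, Nat.cast_one]
  · rintro ⟨hUB1, hUB2, hLB3⟩ W _ _ p _ hord N _ f hf
    have h1 := stub_constantCoeff_eq_zero_iff W p hord f hf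
    -- lower bound `1 ≤ ord` as soon as `r_an ≥ 1` (S1)
    have hLB1 : 1 ≤ W.analyticRank → ((1 : ℕ) : ℕ∞) ≤
        (Literature.NumberTheory.EllipticCurves.padicLFunction f
          (Literature.NumberTheory.EllipticCurves.unitRoot W p : ℚ_[p])).order := fun hpos => by
      refine PowerSeries.nat_le_order _ 1 fun i hi => ?_
      have hi0 : i = 0 := by omega
      subst hi0
      simpa only [PowerSeries.coeff_zero_eq_constantCoeff] using h1.mpr hpos
    rcases Nat.lt_or_ge W.analyticRank 1 with h0 | hpos
    · have hr : W.analyticRank = 0 := by omega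
      have hc : PowerSeries.constantCoeff (Literature.NumberTheory.EllipticCurves.padicLFunction f
          (Literature.NumberTheory.EllipticCurves.unitRoot W p : ℚ_[p])) ≠ 0 := by
        intro h
        have := h1.mp h
        omega
      rw [hr, Nat.cast_zero]
      refine PowerSeries.order_eq_nat.mpr ⟨?_, fun i hi => (Nat.not_lt_zero i hi).elim⟩
      simpa only [PowerSeries.coeff_zero_eq_constantCoeff] using hc
    · apply le_antisymm
      · rcases Nat.lt_or_ge W.analyticRank 2 with hlt2 | h2
        · have hr : W.analyticRank = 1 := by omega
          rw [hr, Nat.cast_one]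
          exact hUB1 W p hord f hf hr
        · exact hUB2 W p hord f hf h2
      · rcases Nat.lt_or_ge W.analyticRank 2 with hlt2 | h2
        · have hr : W.analyticRank = 1 := by omega
          rw [hr]
          exact hLB1 hpos
        · rcases Nat.lt_or_ge W.analyticRank 3 with hlt3 | h3
          · have hr : W.analyticRank = 2 := by omega
            rw [hr, Nat.cast_ofNat]
            exact stub_two_le_order_of_analyticRank_eq_two W p hord f hf hr
          · exact hLB3 W p hord f hf h3

/-- **The Selmer side at odd `p`, `r_an ≥ 2`: `corank_{ℤ_p} Sel_{p^∞}(E/ℚ) = r_an`** from route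
SelmerRank's items at `p ≥ 5` (`SelmerRankUB`/`SelmerRankLB` under surjective `ρ̄_{E,p}`,
`SelmerRankSmallImage` otherwise) and from the same statement at `p = 3` (line `Sketch`'s stub
SEL3, hypothesis `hSEL3`). Pure case analysis on `p`. [cite: GreenbergLNM1716, §1 Conj. 1.13 (p. 65)] -/
theorem pAdicOrderComparisonR2_selmerSide_of_items (hLB : SelmerRankLB) (hUB : SelmerRankUB)
    (hSI : SelmerRankSmallImage)
    (hSEL3 : ∀ (W : WeierstrassCurve ℚ) [W.IsElliptic] [W.IsGloballyMinimal] (p : ℕ) [Fact p.Prime],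
      p = 3 → Literature.NumberTheory.EllipticCurves.IsOrdinaryAt W p → 2 ≤ W.analyticRank →
        W.selmerCorank p = W.analyticRank)
    (W : WeierstrassCurve ℚ) [W.IsElliptic] [W.IsGloballyMinimal] (p : ℕ) [Fact p.Prime]
    (hp2 : p ≠ 2) (hord : IsOrdinaryAt W p) (h2 : 2 ≤ W.analyticRank) :
    W.selmerCorank p = W.analyticRank := by
  rcases Nat.lt_or_ge p 5 with hp5 | hp5
  · have h2le := (Fact.out : p.Prime).two_le
    have hp4 : p ≠ 4 := by
      rintro rfl
      exact absurd (Fact.out : Nat.Prime 4) (by decide)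
    exact hSEL3 W p (by omega) hord h2
  · by_cases hs : W.HasSurjectiveModNGaloisRep p
    · exact le_antisymm (hUB W p hp5 hord.1 hord.2 hs) (hLB W p hp5 hord.1 hord.2 hs)
    · exact hSI W p hp5 hord.1 hord.2 hs

/-- **Lower bound at odd `p`, `r_an ≥ 2`, from Kato's corank bound and the Selmer side**:
if `corank Sel_{p^∞}(E/ℚ) ≤ ord_T L_p(E,T)` at every odd good ordinary `p` (hypothesis `hK`, the
∀-closure of the tree fact `kato_selmerCorank_le_order_padicLFunction`, Kato Thm. 18.4) and
`corank Sel_{p^∞}(E/ℚ) = r_an` whenever `2 ≤ r_an` (hypothesis `hSel`, the Selmer side), then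
`r_an ≤ ord_{T=0} L_p(E,T)` for every odd good ordinary `p`, the newform `f` of `E` and `2 ≤ r_an`
— in analytic rank `2` already by parity (landed leg L2), unconditionally.
[cite: Kato2004Asterisque, Thm 18.4 (p. 281)] -/
theorem pAdicOrderComparisonR2_lb_odd_of_kato
    (hK : ∀ (W : WeierstrassCurve ℚ) [W.IsElliptic] [W.IsGloballyMinimal] (p : ℕ) [Fact p.Prime]
      {N : ℕ} [NeZero N] (f : CuspForm (CongruenceSubgroup.Gamma0 N) 2),
      p ≠ 2 → Literature.NumberTheory.EllipticCurves.IsOrdinaryAt W p →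
        Literature.NumberTheory.EllipticCurves.ModularForms.IsNewformOf W f →
          (W.selmerCorank p : ℕ∞) ≤
            (Literature.NumberTheory.EllipticCurves.padicLFunction f
              (Literature.NumberTheory.EllipticCurves.unitRoot W p : ℚ_[p])).order)
    (hSel : ∀ (W : WeierstrassCurve ℚ) [W.IsElliptic] [W.IsGloballyMinimal] (p : ℕ) [Fact p.Prime],
      p ≠ 2 → Literature.NumberTheory.EllipticCurves.IsOrdinaryAt W p → 2 ≤ W.analyticRank →
        W.selmerCorank p = W.analyticRank) :
    ∀ (W : WeierstrassCurve ℚ) [W.IsElliptic] [W.IsGloballyMinimal] (p : ℕ) [Fact p.Prime],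
      p ≠ 2 → Literature.NumberTheory.EllipticCurves.IsOrdinaryAt W p →
      ∀ {N : ℕ} [NeZero N] (f : CuspForm (CongruenceSubgroup.Gamma0 N) 2),
        Literature.NumberTheory.EllipticCurves.ModularForms.IsNewformOf W f →
          2 ≤ W.analyticRank →
            (W.analyticRank : ℕ∞) ≤ (Literature.NumberTheory.EllipticCurves.padicLFunction f
              (Literature.NumberTheory.EllipticCurves.unitRoot W p : ℚ_[p])).order := by
  intro W _ _ p _ hp2 hord N _ f hf h2
  rcases Nat.lt_or_ge W.analyticRank 3 with hlt3 | _
  · have hr : W.analyticRank = 2 := by omega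
    rw [hr, Nat.cast_ofNat]
    exact stub_two_le_order_of_analyticRank_eq_two W p hord f hf hr
  · rw [← hSel W p hp2 hord h2]
    exact hK W p f hp2 hord hf

/-- **The lower-bound half of crux #2 at odd `p` is literature debt modulo the Selmer side**:
from the ∀-closure of Kato's divisibility (tree fact `kato_divisibility`, Kato Thm. 17.4:
`X(E/ℚ_∞)` is `Λ`-torsion and `char_Λ X ∋ g` with `ι g = p^n L_p(E,T)`), through the tree
theorem `kato_selmerCorank_le_order_padicLFunction_of_kato_divisibility`
(`corank Sel ≤ rank_{ℤ_p} X/TX ≤ ord_T g ≤ ord_T (p^n L_p) = ord_T L_p`), and the Selmer side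
`hSel`: `r_an ≤ ord_{T=0} L_p(E,T)` at every odd good ordinary `p` when `2 ≤ r_an`.
[cite: Kato2004Asterisque, Thm 17.4 (p. 273) and Thm 18.4 (p. 281)] -/
theorem pAdicOrderComparisonR2_lb_odd_of_kato_divisibility
    (hKD : ∀ (W : WeierstrassCurve ℚ) [W.IsElliptic] [W.IsGloballyMinimal] (p : ℕ) [Fact p.Prime]
      (κ : ZpExtension ℚ p) (γ : Field.absoluteGaloisGroup ℚ)
      {N : ℕ} [NeZero N] (f : CuspForm (CongruenceSubgroup.Gamma0 N) 2),
      kato_divisibility W p (κ := κ) (γ := γ) (f := f))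
    (hSel : ∀ (W : WeierstrassCurve ℚ) [W.IsElliptic] [W.IsGloballyMinimal] (p : ℕ) [Fact p.Prime],
      p ≠ 2 → Literature.NumberTheory.EllipticCurves.IsOrdinaryAt W p → 2 ≤ W.analyticRank →
        W.selmerCorank p = W.analyticRank) :
    ∀ (W : WeierstrassCurve ℚ) [W.IsElliptic] [W.IsGloballyMinimal] (p : ℕ) [Fact p.Prime],
      p ≠ 2 → Literature.NumberTheory.EllipticCurves.IsOrdinaryAt W p →
      ∀ {N : ℕ} [NeZero N] (f : CuspForm (CongruenceSubgroup.Gamma0 N) 2),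
        Literature.NumberTheory.EllipticCurves.ModularForms.IsNewformOf W f →
          2 ≤ W.analyticRank →
            (W.analyticRank : ℕ∞) ≤ (Literature.NumberTheory.EllipticCurves.padicLFunction f
              (Literature.NumberTheory.EllipticCurves.unitRoot W p : ℚ_[p])).order :=
  pAdicOrderComparisonR2_lb_odd_of_kato
    (fun W _ _ p _ _ _ f hp hord hf =>
      kato_selmerCorank_le_order_padicLFunction_of_kato_divisibility W p (fun κ γ => hKD W p κ γ f)
        hp hord hf)
    hSel

end Summit.BirchSwinnertonDyer.BirchSwinnertonDyer.Theorems
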